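import Summits.CriticalPhenomena.SAWScalingLimit.Theses.SAWTensorRG
import Summits.CriticalPhenomena.SAWScalingLimit.Theorems.SAWConePseudogroupLatticeSimilarityOfLimitTransport
import Literature.Probability.RandomPlanarGeometry.SAWScalingLimitFamily
import HarnessLib

/-!
# Translation invariance of the critical-SAW hull-avoidance limits
# (crux `ConformalAvoidance` of route SAWTensorRG, item stmt-CriticalPhenomena-7605, line `birth`,
# stub `stub_translationInvariantLimits`)

Helper file (`--supports stmt-CriticalPhenomena-7605`). We prove the registered stub
`stub_translationInvariantLimits` of the line skeleton `Cruxes/ConformalAvoidance/Lines/birth.lean`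
(lead's reshape r1): **if** the hull-avoidance limits
`lim_{δ → 0+} P_δ^{D}(range γ ⊆ closure D')` exist for EVERY endpoint approximation of every hull pair
`D ⊇ D'` (hypothesis `AvoidanceLimitExists`) **and** do not depend on the endpoint approximation
(hypothesis `ApproxIndependentLimits`), **then** the limit values agree across two configurations
`(D, D'; a, b)` and `(E, E'; c, d)` related by a plane translation `z ↦ z + w`, for EVERY `w ∈ ℂ`
(carriers and marked points transported).

## Proof (exact lattice symmetry along special meshes + uniqueness of limits)

A translation by `w` is a symmetry of `δℤ²` only when `w ∈ δℤ²`. Write `w = u + i v`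
(`Complex.re_add_im`) and go in two axis-parallel steps through the intermediate pair
`(u + D, u + D') = (D.map τᵤ, D'.map τᵤ)`, `τᵤ = similarity 1 _ u`:

* **One lattice step** (`translate_step`): let `t ∈ ℂ` be a lattice vector `t = δₙ vₙ` along
  positive meshes `δₙ → 0` (for `t = u ∈ ℝ` resp. `t = i v` take `δₙ = |u|/(n+1)`,
  `exists_mesh_seq`, `vₙ = (kₙ, 0)` resp. `(0, kₙ)`). Given an endpoint approximation `(a, b)` of `D`
  whose avoidance values tend to `r`, SPLICE an endpoint approximation `(e, f)` of `t + D`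
  (`isEndpointApprox_splice`: `a δ + v_δ` at the meshes where `t = δ v_δ ∈ δℤ²`, any endpoint
  approximation of `t + D` — `SAW.exists_isEndpointApprox` — elsewhere). At the meshes `δₙ` the
  avoidance probability of `(t + D, t + D'; e, f)` IS that of `(D, D'; a, b)`
  (`map_curve_law_translate` evaluated on the avoidance event, whose pull-back along `γ ↦ τ ∘ γ` is
  the avoidance event, `preimage_map_rangeSubset`). The full-filter limit `s` of the spliced
  configuration exists by `AvoidanceLimitExists`, and along `δₙ` both `s` and `r` are limits of the
  same sequence, so `s = r` (`tendsto_nhds_unique`).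
* Step 1 (`u = Re w`) transports the hull hypotheses to `(u + D, u + D')` (`hull_translate`:
  translates of balls are balls) and yields an approximation of `u + D` with avoidance limit `r₁`;
  step 2 (`i v`, `v = Im w`) lands in the GIVEN pair `(E, E')` (its hull hypotheses are
  hypotheses) and yields an approximation `(e', f')` of `E` with avoidance limit `r₁`; finally
  `ApproxIndependentLimits` at `(E, E')` between `(e', f')` and `(c, d)` gives `r₁ = r₂`.

References: G. F. Lawler, O. Schramm, W. Werner, *On the scaling limit of planar self-avoiding
walk* (2004), §3.4.2 (lattice symmetries of the putative limit); V. Beffara, *Is critical 2D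
percolation universal?* (2008), §2.2; P. Billingsley, *Convergence of probability measures*, 2nd ed.
(1999), Thm 1.2 (uniqueness of limits). All [folklore].
-/

noncomputable section

open scoped Topology ENNReal NNReal
open Filter Set MeasureTheory
open Literature.Probability.RandomPlanarGeometry Literature.Probability.LatticeModels
open Summit.CriticalPhenomena.SAWScalingLimit.Theorems.LatticeSimilarityOfLimit
  (map_curve_law_translate map_curve_law_congr isEndpointApprox_splice)

namespace Summit.CriticalPhenomena.SAWScalingLimit.Theorems.ConformalAvoidance

/-! ### Plane translations: elementary geometry -/

/-- A translate of a ball is the ball about the translated centre. [folklore] -/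
private theorem image_ball_translate (u p : ℂ) (ε : ℝ) :
    (similarity 1 one_ne_zero u) '' Metric.ball p ε = Metric.ball (similarity 1 one_ne_zero u p) ε := by
  ext z
  simp only [mem_image, similarity_apply, one_mul, Metric.mem_ball]
  constructor
  · rintro ⟨y, hy, rfl⟩
    rwa [dist_add_right]
  · intro hz
    exact ⟨z - u, by rwa [← dist_add_right _ _ u, sub_add_cancel], sub_add_cancel z u⟩

/-- Translating a set and cutting with the translated ball is translating the cut set. [folklore] -/
private theorem image_inter_ball_translate (u : ℂ) (X : Set ℂ) (p : ℂ) (ε : ℝ) :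
    (similarity 1 one_ne_zero u) '' X ∩ Metric.ball (similarity 1 one_ne_zero u p) ε =
      (similarity 1 one_ne_zero u) '' (X ∩ Metric.ball p ε) := by
  rw [image_inter (similarity 1 one_ne_zero u).injective, image_ball_translate]

/-- **The hull hypotheses are transported by a translation**: if `D' ⊆ D` have the same marked
points and agree in `ε`-balls around them, so do `u + D' ⊆ u + D`. [folklore] -/
private theorem hull_translate (u : ℂ) {D D' : DobrushinDomain} (hsub : D'.carrier ⊆ D.carrier)
    (h0 : D'.pt 0 = D.pt 0) (h1 : D'.pt 1 = D.pt 1)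
    (hball : ∃ ε : ℝ, 0 < ε ∧
      D'.carrier ∩ Metric.ball (D.pt 0) ε = D.carrier ∩ Metric.ball (D.pt 0) ε ∧
        D'.carrier ∩ Metric.ball (D.pt 1) ε = D.carrier ∩ Metric.ball (D.pt 1) ε) :
    (D'.map (similarity 1 one_ne_zero u)).carrier ⊆ (D.map (similarity 1 one_ne_zero u)).carrier ∧
      (D'.map (similarity 1 one_ne_zero u)).pt 0 = (D.map (similarity 1 one_ne_zero u)).pt 0 ∧
      (D'.map (similarity 1 one_ne_zero u)).pt 1 = (D.map (similarity 1 one_ne_zero u)).pt 1 ∧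
      ∃ ε : ℝ, 0 < ε ∧
        (D'.map (similarity 1 one_ne_zero u)).carrier ∩
            Metric.ball ((D.map (similarity 1 one_ne_zero u)).pt 0) ε =
          (D.map (similarity 1 one_ne_zero u)).carrier ∩
            Metric.ball ((D.map (similarity 1 one_ne_zero u)).pt 0) ε ∧
        (D'.map (similarity 1 one_ne_zero u)).carrier ∩
            Metric.ball ((D.map (similarity 1 one_ne_zero u)).pt 1) ε =
          (D.map (similarity 1 one_ne_zero u)).carrier ∩
            Metric.ball ((D.map (similarity 1 one_ne_zero u)).pt 1) ε := by
  obtain ⟨ε, hε, hb0, hb1⟩ := hball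
  simp only [MarkedDomain.carrier_map, MarkedDomain.pt_map]
  refine ⟨image_mono hsub, by rw [h0], by rw [h1], ε, hε, ?_, ?_⟩
  · rw [image_inter_ball_translate, image_inter_ball_translate, hb0]
  · rw [image_inter_ball_translate, image_inter_ball_translate, hb1]

/-- The two axis-parallel steps compose to the translation: `(z + Re w) + i Im w = z + w`.
[folklore] -/
private theorem translate_re_then_im (w z : ℂ) :
    similarity 1 one_ne_zero ((w.im : ℂ) * Complex.I) (similarity 1 one_ne_zero (w.re : ℂ) z) =
      similarity 1 one_ne_zero w z := by
  simp only [similarity_apply, one_mul]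
  rw [add_assoc, Complex.re_add_im]

/-- The two axis-parallel steps compose to the translation, on images of sets. [folklore] -/
private theorem image_translate_re_then_im (w : ℂ) (X : Set ℂ) :
    (similarity 1 one_ne_zero ((w.im : ℂ) * Complex.I)) ''
        ((similarity 1 one_ne_zero (w.re : ℂ)) '' X) =
      (similarity 1 one_ne_zero w) '' X := by
  rw [image_image]
  exact image_congr fun z _ => translate_re_then_im w z

/-! ### Meshes along which a real translation is a lattice vector -/

-- adapted from SAWConePseudogroupLatticeSimilarityOfLimit.exists_mesh_seq (same statement and
-- proof; copied to avoid importing that file's large import cone)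
/-- Real translations `t ∈ ℝ` are lattice vectors along suitable meshes: `t = δₙ kₙ` with
`δₙ > 0`, `δₙ → 0`, `kₙ ∈ ℤ` (take `δₙ = |t|/(n+1)`). [folklore] -/
private theorem exists_mesh_seq (t : ℝ) :
    ∃ (δs : ℕ → ℝ) (k : ℕ → ℤ), (∀ n, 0 < δs n) ∧ Tendsto δs atTop (𝓝 0) ∧
      ∀ n, δs n * k n = t := by
  rcases lt_trichotomy t 0 with ht | rt | ht
  · refine ⟨fun n => -t / ((n : ℝ) + 1), fun n => -((n : ℤ) + 1),
      fun n => div_pos (by linarith) (by positivity), ?_, fun n => ?_⟩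
    · have h := (tendsto_one_div_add_atTop_nhds_zero_nat (𝕜 := ℝ)).const_mul (-t)
      rw [mul_zero] at h
      exact Tendsto.congr (fun n => by ring) h
    · push_cast
      field_simp
  · subst rt
    exact ⟨fun n => 1 / ((n : ℝ) + 1), fun _ => 0, fun _ => Nat.one_div_pos_of_nat,
      tendsto_one_div_add_atTop_nhds_zero_nat, fun n => by simp⟩
  · refine ⟨fun n => t / ((n : ℝ) + 1), fun n => (n : ℤ) + 1, fun n => by positivity, ?_,
      fun n => ?_⟩
    · have h := (tendsto_one_div_add_atTop_nhds_zero_nat (𝕜 := ℝ)).const_mul t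
      rw [mul_zero] at h
      exact Tendsto.congr (fun n => by ring) h
    · push_cast
      field_simp

/-! ### The avoidance event under a plane homeomorphism; exact covariance at lattice meshes -/

/-- Pulling the avoidance event `{range γ ⊆ closure (φ S)}` back along `γ ↦ φ ∘ γ` gives the
avoidance event `{range γ ⊆ closure S}` (`φ` a homeomorphism of the plane). [folklore] -/
private theorem preimage_map_rangeSubset (φ : ℂ ≃ₜ ℂ) (S : Set ℂ) :
    (CurveClass.map (φ : C(ℂ, ℂ))) ⁻¹' CurveClass.rangeSubset (closure (φ '' S)) =
      CurveClass.rangeSubset (closure S) := by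
  ext c
  rw [mem_preimage, CurveClass.mem_rangeSubset, CurveClass.mem_rangeSubset, CurveClass.range_map,
    ContinuousMap.coe_coe, ← φ.image_closure, image_subset_image_iff φ.injective]

/-- **Exact translation covariance of the avoidance probability at a lattice mesh**: if
`w = δ v ∈ δℤ²`, the probability that the critical SAW of `(w + Ω)_δ` from `a + v` to `b + v`
stays in `closure (w + S)` equals the probability that the critical SAW of `Ω_δ` from `a` to `b`
stays in `closure S` (`map_curve_law_translate` evaluated on the avoidance event). [folklore] -/
private theorem avoidance_translate {Ω Ω' S S' : Set ℂ} {w : ℂ}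
    (hΩ : Ω' = (similarity 1 one_ne_zero w) '' Ω) (hS : S' = (similarity 1 one_ne_zero w) '' S)
    (δ : ℝ) {v : Site 2} (hv : meshPoint δ v = w) (a b : Site 2) :
    ((SAW.law Ω' δ (a + v) (b + v)).map (fun γ => γ.curve)) (CurveClass.rangeSubset (closure S')) =
      ((SAW.law Ω δ a b).map (fun γ => γ.curve)) (CurveClass.rangeSubset (closure S)) := by
  subst hΩ hS
  rw [← map_curve_law_translate Ω δ v hv a b,
    Measure.map_apply (measurable_curveClassMap_similarity _ _ _)
      (CurveClass.measurableSet_rangeSubset isClosed_closure),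
    preimage_map_rangeSubset]

/-! ### Spliced endpoint approximations and the one-step identification -/

/-- **Spliced endpoint approximation of a translated domain.** For an endpoint approximation
`(a, b)` of `D` and a Dobrushin domain `F` with carrier `w + D.carrier` and marked points
`w + D.pt i`, there is an endpoint approximation `(e, f)` of `F` which, at every mesh `δ` with
`w ∈ δℤ²`, is the translate `(a δ + v, b δ + v)` by a lattice vector `v` with `δ v = w`
(`isEndpointApprox_splice` with any endpoint approximation of `F`, `SAW.exists_isEndpointApprox`,
at the other meshes). [folklore] -/
private theorem exists_spliced_approx {D F : DobrushinDomain} (w : ℂ) {a b : ℝ → Site 2}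
    (hab : SAW.IsEndpointApprox D a b)
    (hF : F.carrier = (similarity 1 one_ne_zero w) '' D.carrier)
    (hF0 : F.pt 0 = (similarity 1 one_ne_zero w) (D.pt 0))
    (hF1 : F.pt 1 = (similarity 1 one_ne_zero w) (D.pt 1)) :
    ∃ e f : ℝ → Site 2, SAW.IsEndpointApprox F e f ∧
      ∀ δ : ℝ, (∃ u : Site 2, meshPoint δ u = w) →
        ∃ v : Site 2, meshPoint δ v = w ∧ e δ = a δ + v ∧ f δ = b δ + v := by
  classical
  obtain ⟨e₀, f₀, h₀⟩ := SAW.exists_isEndpointApprox F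
  have h₀' : SAW.IsEndpointApprox (D.map (similarity 1 one_ne_zero w)) e₀ f₀ :=
    h₀.congr hF hF0 hF1
  set v : ℝ → Site 2 := fun δ => if h : ∃ u : Site 2, meshPoint δ u = w then h.choose else 0
    with hv_def
  have hp : ∀ δ, (∃ u : Site 2, meshPoint δ u = w) → meshPoint δ (v δ) = w := fun δ h => by
    simp only [hv_def, dif_pos h]
    exact h.choose_spec
  have happ := isEndpointApprox_splice w hab h₀' v (fun δ => ∃ u : Site 2, meshPoint δ u = w) hp
  refine ⟨_, _, happ.congr hF.symm hF0.symm hF1.symm, fun δ hδ => ⟨v δ, hp δ hδ, ?_, ?_⟩⟩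
  · exact if_pos hδ
  · exact if_pos hδ

/-- **One lattice step.** Assume the hull-avoidance limits exist for every endpoint approximation
of every hull pair. Let `w = δₙ vₙ` be a lattice vector along positive meshes `δₙ → 0`, let
`(F, F')` be a hull pair with `F = w + D`, `F' = w + D'` (carriers) and marked points `w + D.pt i`,
and let the avoidance values of `(D, D'; a, b)` tend to `r`. Then some endpoint approximation of
`F` has avoidance values (for `F'`) tending to the SAME `r`: the spliced approximation has a limit
`s` by hypothesis, and along `δₙ` its avoidance values are exactly those of `(D, D'; a, b)`
(`avoidance_translate`), so `s = r` by uniqueness of limits. [folklore] -/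
private theorem translate_step
    (hALE : ∀ (D D' : DobrushinDomain) (a b : ℝ → Site 2), SAW.IsEndpointApprox D a b →
      D'.carrier ⊆ D.carrier → D'.pt 0 = D.pt 0 → D'.pt 1 = D.pt 1 →
      (∃ ε : ℝ, 0 < ε ∧ D'.carrier ∩ Metric.ball (D.pt 0) ε = D.carrier ∩ Metric.ball (D.pt 0) ε ∧
        D'.carrier ∩ Metric.ball (D.pt 1) ε = D.carrier ∩ Metric.ball (D.pt 1) ε) →
      ∃ r : ENNReal,
        Tendsto (fun δ => ((SAW.law D.carrier δ (a δ) (b δ)).map (fun γ => γ.curve))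
            (CurveClass.rangeSubset (closure D'.carrier))) (𝓝[>] 0) (𝓝 r))
    {D D' F F' : DobrushinDomain} {a b : ℝ → Site 2} {w : ℂ} {δs : ℕ → ℝ} {vs : ℕ → Site 2}
    (hδ : ∀ n, 0 < δs n) (hδ0 : Tendsto δs atTop (𝓝 0)) (hvs : ∀ n, meshPoint (δs n) (vs n) = w)
    (hab : SAW.IsEndpointApprox D a b)
    (hF : F.carrier = (similarity 1 one_ne_zero w) '' D.carrier)
    (hF' : F'.carrier = (similarity 1 one_ne_zero w) '' D'.carrier)
    (hF0 : F.pt 0 = (similarity 1 one_ne_zero w) (D.pt 0))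
    (hF1 : F.pt 1 = (similarity 1 one_ne_zero w) (D.pt 1))
    (hsub : F'.carrier ⊆ F.carrier) (h0 : F'.pt 0 = F.pt 0) (h1 : F'.pt 1 = F.pt 1)
    (hball : ∃ ε : ℝ, 0 < ε ∧
      F'.carrier ∩ Metric.ball (F.pt 0) ε = F.carrier ∩ Metric.ball (F.pt 0) ε ∧
        F'.carrier ∩ Metric.ball (F.pt 1) ε = F.carrier ∩ Metric.ball (F.pt 1) ε)
    {r : ENNReal}
    (hr : Tendsto (fun δ => ((SAW.law D.carrier δ (a δ) (b δ)).map (fun γ => γ.curve))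
        (CurveClass.rangeSubset (closure D'.carrier))) (𝓝[>] 0) (𝓝 r)) :
    ∃ e f : ℝ → Site 2, SAW.IsEndpointApprox F e f ∧
      Tendsto (fun δ => ((SAW.law F.carrier δ (e δ) (f δ)).map (fun γ => γ.curve))
        (CurveClass.rangeSubset (closure F'.carrier))) (𝓝[>] 0) (𝓝 r) := by
  obtain ⟨e, f, hef, hsplice⟩ := exists_spliced_approx w hab hF hF0 hF1
  obtain ⟨s, hs⟩ := hALE F F' e f hef hsub h0 h1 hball
  have hδ' : Tendsto δs atTop (𝓝[>] (0 : ℝ)) :=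
    tendsto_nhdsWithin_iff.2 ⟨hδ0, Eventually.of_forall hδ⟩
  have hsr : s = r := by
    refine tendsto_nhds_unique ((hs.comp hδ').congr fun n => ?_) (hr.comp hδ')
    obtain ⟨v, hv, he, hf⟩ := hsplice (δs n) ⟨vs n, hvs n⟩
    simp only [Function.comp_apply]
    rw [map_curve_law_congr he hf]
    exact avoidance_translate hF hF' (δs n) hv (a (δs n)) (b (δs n))
  subst hsr
  exact ⟨e, f, hef, hs⟩

/-! ### The stub -/

/-- **STUB 2b of line `birth` of crux `ConformalAvoidance` (route SAWTensorRG): existence of the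
hull-avoidance limits for every endpoint approximation + approximation independence ⇒ invariance of
the limit values under every plane translation `z ↦ z + w`, `w ∈ ℂ`** (carriers AND marked points
transported; literal registered signature `AvoidanceLimitExists → ApproxIndependentLimits →
TranslationInvariantLimits`). Two axis-parallel lattice steps `Re w` then `i Im w`
(`translate_step` along the meshes `δₙ = |t|/(n+1)` of `exists_mesh_seq`, through the intermediate
pair `(D.map τ, D'.map τ)`, `τ = similarity 1 _ (Re w)`, whose hull hypotheses are transported by
`hull_translate`), then approximation independence at `(E, E')`. [folklore] -/
theorem stub_translationInvariantLimits :
    (∀ (D D' : DobrushinDomain) (a b : ℝ → Site 2), SAW.IsEndpointApprox D a b →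
      D'.carrier ⊆ D.carrier → D'.pt 0 = D.pt 0 → D'.pt 1 = D.pt 1 →
      (∃ ε : ℝ, 0 < ε ∧ D'.carrier ∩ Metric.ball (D.pt 0) ε = D.carrier ∩ Metric.ball (D.pt 0) ε ∧
        D'.carrier ∩ Metric.ball (D.pt 1) ε = D.carrier ∩ Metric.ball (D.pt 1) ε) →
      ∃ r : ENNReal,
        Tendsto (fun δ => ((SAW.law D.carrier δ (a δ) (b δ)).map (fun γ => γ.curve))
            (CurveClass.rangeSubset (closure D'.carrier))) (𝓝[>] 0) (𝓝 r)) →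
    (∀ (D D' : DobrushinDomain) (a b c d : ℝ → Site 2),
      SAW.IsEndpointApprox D a b → SAW.IsEndpointApprox D c d →
      D'.carrier ⊆ D.carrier → D'.pt 0 = D.pt 0 → D'.pt 1 = D.pt 1 →
      (∃ ε : ℝ, 0 < ε ∧ D'.carrier ∩ Metric.ball (D.pt 0) ε = D.carrier ∩ Metric.ball (D.pt 0) ε ∧
        D'.carrier ∩ Metric.ball (D.pt 1) ε = D.carrier ∩ Metric.ball (D.pt 1) ε) →
      ∀ r₁ r₂ : ENNReal,
        Tendsto (fun δ => ((SAW.law D.carrier δ (a δ) (b δ)).map (fun γ => γ.curve))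
            (CurveClass.rangeSubset (closure D'.carrier))) (𝓝[>] 0) (𝓝 r₁) →
        Tendsto (fun δ => ((SAW.law D.carrier δ (c δ) (d δ)).map (fun γ => γ.curve))
            (CurveClass.rangeSubset (closure D'.carrier))) (𝓝[>] 0) (𝓝 r₂) → r₁ = r₂) →
    ∀ (D D' E E' : DobrushinDomain) (a b c d : ℝ → Site 2) (w : ℂ),
      SAW.IsEndpointApprox D a b → SAW.IsEndpointApprox E c d →
      D'.carrier ⊆ D.carrier → D'.pt 0 = D.pt 0 → D'.pt 1 = D.pt 1 →
      (∃ ε : ℝ, 0 < ε ∧ D'.carrier ∩ Metric.ball (D.pt 0) ε = D.carrier ∩ Metric.ball (D.pt 0) ε ∧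
        D'.carrier ∩ Metric.ball (D.pt 1) ε = D.carrier ∩ Metric.ball (D.pt 1) ε) →
      E'.carrier ⊆ E.carrier → E'.pt 0 = E.pt 0 → E'.pt 1 = E.pt 1 →
      (∃ ε : ℝ, 0 < ε ∧ E'.carrier ∩ Metric.ball (E.pt 0) ε = E.carrier ∩ Metric.ball (E.pt 0) ε ∧
        E'.carrier ∩ Metric.ball (E.pt 1) ε = E.carrier ∩ Metric.ball (E.pt 1) ε) →
      E.carrier = (similarity 1 one_ne_zero w) '' D.carrier →
      E'.carrier = (similarity 1 one_ne_zero w) '' D'.carrier →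
      E.pt 0 = (similarity 1 one_ne_zero w) (D.pt 0) → E.pt 1 = (similarity 1 one_ne_zero w) (D.pt 1) →
      ∀ r₁ r₂ : ENNReal,
        Tendsto (fun δ => ((SAW.law D.carrier δ (a δ) (b δ)).map (fun γ => γ.curve))
            (CurveClass.rangeSubset (closure D'.carrier))) (𝓝[>] 0) (𝓝 r₁) →
        Tendsto (fun δ => ((SAW.law E.carrier δ (c δ) (d δ)).map (fun γ => γ.curve))
            (CurveClass.rangeSubset (closure E'.carrier))) (𝓝[>] 0) (𝓝 r₂) → r₁ = r₂ := by
  intro hALE hAIL D D' E E' a b c d w hab hcd hsub h0 h1 hball hsubE h0E h1E hballE hE hE' hE0 hE1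
    r₁ r₂ hr₁ hr₂
  -- Step 1: the real translation `z ↦ z + Re w`, a lattice vector along `δₙ = |Re w|/(n+1)`,
  -- into the intermediate pair `(Re w + D, Re w + D')`.
  obtain ⟨δs, k, hδ, hδ0, hk⟩ := exists_mesh_seq w.re
  have hvs : ∀ n, meshPoint (δs n) ![k n, 0] = (w.re : ℂ) := fun n => by
    apply Complex.ext
    · simp [← hk n]
    · simp
  obtain ⟨hsub₁, h0₁, h1₁, hball₁⟩ := hull_translate (w.re : ℂ) hsub h0 h1 hball
  obtain ⟨e, f, hef, her⟩ := translate_step hALE (F := D.map (similarity 1 one_ne_zero (w.re : ℂ)))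
    (F' := D'.map (similarity 1 one_ne_zero (w.re : ℂ))) hδ hδ0 hvs hab rfl rfl rfl rfl hsub₁ h0₁ h1₁
    hball₁ hr₁
  -- Step 2: the imaginary translation `z ↦ z + i Im w`, a lattice vector along
  -- `δₙ' = |Im w|/(n+1)`, from the intermediate pair into the given pair `(E, E')`.
  obtain ⟨δs', k', hδ', hδ0', hk'⟩ := exists_mesh_seq w.im
  have hvs' : ∀ n, meshPoint (δs' n) ![0, k' n] = (w.im : ℂ) * Complex.I := fun n => by
    apply Complex.ext
    · simp
    · simp [← hk' n]
  have hE₂ : E.carrier = (similarity 1 one_ne_zero ((w.im : ℂ) * Complex.I)) ''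
      (D.map (similarity 1 one_ne_zero (w.re : ℂ))).carrier := by
    rw [MarkedDomain.carrier_map, image_translate_re_then_im]
    exact hE
  have hE'₂ : E'.carrier = (similarity 1 one_ne_zero ((w.im : ℂ) * Complex.I)) ''
      (D'.map (similarity 1 one_ne_zero (w.re : ℂ))).carrier := by
    rw [MarkedDomain.carrier_map, image_translate_re_then_im]
    exact hE'
  have hE0₂ : E.pt 0 = (similarity 1 one_ne_zero ((w.im : ℂ) * Complex.I))
      ((D.map (similarity 1 one_ne_zero (w.re : ℂ))).pt 0) := by
    rw [MarkedDomain.pt_map, translate_re_then_im]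
    exact hE0
  have hE1₂ : E.pt 1 = (similarity 1 one_ne_zero ((w.im : ℂ) * Complex.I))
      ((D.map (similarity 1 one_ne_zero (w.re : ℂ))).pt 1) := by
    rw [MarkedDomain.pt_map, translate_re_then_im]
    exact hE1
  obtain ⟨e', f', hef', her'⟩ := translate_step hALE hδ' hδ0' hvs' hef hE₂ hE'₂ hE0₂ hE1₂ hsubE h0E
    h1E hballE her
  -- Approximation independence at `(E, E')`.
  exact hAIL E E' e' f' c d hef' hcd hsubE h0E h1E hballE r₁ r₂ her' hr₂

end Summit.CriticalPhenomena.SAWScalingLimit.Theorems.ConformalAvoidance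

end
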